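import Mathlib
import Summits.Ventures.HodgeRepro.Tier4.Line4.ArchProdCutoff

/-!
# Tier4/Line4/ArchWitnessCutoff — the CUTOFF WITNESS `archWitnessR R := d3Gen (eM′ w₀) · ∏_{w′ ≠ w₀} cutFactor R w′` (and the
antiholomorphic `archWitnessR'`): `cont`, `infOnly`, the `equiv` clause at EVERY place, the right `T′(𝔸)`-law with the SAME
weight character `torusWeight'`, and the weight-3 `decay` at EVERY sign pattern off `w₀` — NO definiteness hypothesis

Blind re-derivation cell `pub-hodge-repro`, Tier 4 (README §9–§10), seat t4-L1-p5 (prover, gen 5; C-L4-7A-NODEF S15560,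
plan-4's GO S15565; module 3 of 4).  Target tree path `lean/Summits/Ventures/HodgeRepro/Tier4/Line4/ArchWitnessCutoff.lean`.
On the seat's `ArchProdCutoff` (`placeProd`, `cutFactor`), `LocSizeCutoff` (p709514), `D3CoeffGeneral` (p704822: `d3Gen`,
`d3Gen'`, `norm_D3coeff''_eq_norm_D3coeff'`), `ArchFactorProd` (p706229: `d3Gen(')_mul_torus'`, `torusWeight'`),
`ArchProdInfOnly` (p705506: `d3Gen(')_ofInfPart`), `DetTwist` (p704275: `norm_detTwist_le_one`), `D3CoeffDecayConj`
(p701824: **`hasDecay3_of_bump`**); no printed input.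

THE DECAY.  `archWitnessR R = D3coeff' · bump` with `bump := detTwist (eM′ w₀) · ∏_{w′ ≠ w₀} cutFactor R w′`: `‖bump‖ ≤ B :=
∏_{w′ ≠ w₀} (R + 1)^{coeffDegree (eP′ w′) (eM′ w′)}` everywhere (`norm_detTwist_le_one`, `norm_cutFactor_le`), and on its support
every cutoff is non-zero, so `locSize w′ x < R + 1` and `archSizeAt w′ x ≤ locSizeBound w′ · (R + 1) ≤ M := 1 + ∑_{w′}
locSizeBound w′ · (R + 1)` — the `hB`/`hsupp` of p701824's `hasDecay3_of_bump`, which needs only the `U(1,1)` signs at `w₀`.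
Hence `HasDecay3 W (archWitnessR R)` for every `R ≥ 0` with NO hypothesis on the signs of `a` off `w₀`; the `'` branch through
`‖D3coeff''‖ = ‖D3coeff'‖`.

WHAT IS PROVED (kernel, no print): `archWitnessR` / `archWitnessR'` (defs) with `_apply`, `continuous_archWitnessR(')`,
`archWitnessR(')_ofInfPart`, **`cj_archWitnessR(')_inv_mul`** (`IsArchCoeff.equiv` at every place for every displayed `eP′ eM′`
with `he`), **`archWitnessR(')_mul_torus'`** (`= torusWeight' κ · …`), **`decay_archWitnessR(')`** (`∃ C, ∀ x, ‖·‖ ≤ C e^{−3 archDist}`,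
unfolded).  Nothing here says anything about the status of the Hodge conjecture for CM abelian varieties, which is NOT
proved (HC_CM is NOT proved by anyone in this repository).
-/

set_option autoImplicit false

noncomputable section

namespace Summit.Ventures.HodgeRepro.Tier4.Line4

open Summit.Ventures.HodgeRepro.Tier4.Common Summit.Ventures.HodgeRepro.Tier4.Line1 NumberField Matrix

open scoped ComplexConjugate

open scoped Classical

section Witness

variable {k : Type} [Field k] [NumberField k] (q : QuadData k) (a : Fin 4 → k)
  (g g' : Matrix (Fin 4) (Fin 4) k) (hgg' : g * g' = 1) (hg'g : g' * g = 1)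
  (hgΩ : g * (PlaneData.mixedRow q (a 0) (a 2)).Ω = (PlaneData.mixedRow q (a 0) (a 2)).Ω * g)
  (lam : k) (hlam : lam ≠ 0)
  (hiso : g * (PlaneData.mixedRow q (a 1) (a 3)).B * gᵀ = lam • (PlaneData.mixedRow q (a 0) (a 2)).B)
  (w₀ : InfinitePlace k) (eP' eM' : InfinitePlace k → ℤ) (R : ℝ)

/-- **the cutoff witness, holomorphic branch** (`eP′ w₀ = eM′ w₀ + 3`):
`d3Gen w₀ (eM′ w₀) · ∏_{w′ ≠ w₀} defCoeff w′ (eP′ w′) (eM′ w′) · cutoff w′ R`. -/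
def archWitnessR : GA ((PlaneData.mixedRow q (a 0) (a 2)).withTransportedTorus g g' hgg' hg'g hgΩ) → ℂ :=
  d3Gen q a g g' hgg' hg'g hgΩ lam hiso w₀ (eM' w₀) *
    placeProd q a g g' hgg' hg'g hgΩ w₀ (cutFactor q a g g' hgg' hg'g hgΩ lam hiso eP' eM' R)

/-- **the cutoff witness, antiholomorphic branch** (`eM′ w₀ = eP′ w₀ + 3`). -/
def archWitnessR' : GA ((PlaneData.mixedRow q (a 0) (a 2)).withTransportedTorus g g' hgg' hg'g hgΩ) → ℂ :=
  d3Gen' q a g g' hgg' hg'g hgΩ lam hiso w₀ (eP' w₀) *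
    placeProd q a g g' hgg' hg'g hgΩ w₀ (cutFactor q a g g' hgg' hg'g hgΩ lam hiso eP' eM' R)

/-- `archWitnessR R x = d3Gen … x * placeProd … x` (`rfl`). -/
theorem archWitnessR_apply (x : GA ((PlaneData.mixedRow q (a 0) (a 2)).withTransportedTorus g g' hgg' hg'g hgΩ)) :
    archWitnessR q a g g' hgg' hg'g hgΩ lam hiso w₀ eP' eM' R x =
      d3Gen q a g g' hgg' hg'g hgΩ lam hiso w₀ (eM' w₀) x *
        placeProd q a g g' hgg' hg'g hgΩ w₀ (cutFactor q a g g' hgg' hg'g hgΩ lam hiso eP' eM' R) x := rfl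

/-- `archWitnessR' R x = d3Gen' … x * placeProd … x` (`rfl`). -/
theorem archWitnessR'_apply (x : GA ((PlaneData.mixedRow q (a 0) (a 2)).withTransportedTorus g g' hgg' hg'g hgΩ)) :
    archWitnessR' q a g g' hgg' hg'g hgΩ lam hiso w₀ eP' eM' R x =
      d3Gen' q a g g' hgg' hg'g hgΩ lam hiso w₀ (eP' w₀) x *
        placeProd q a g g' hgg' hg'g hgΩ w₀ (cutFactor q a g g' hgg' hg'g hgΩ lam hiso eP' eM' R) x := rfl

/-- continuity (`U(1,1)` signs at `w₀`). -/
theorem continuous_archWitnessR (hw₀ : w₀.IsReal) (hcm₀ : IsCMAt q w₀)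
    (ha1 : 0 < (adToC w₀ (algebraMap k (Ad k) (a 1))).re) (ha3 : (adToC w₀ (algebraMap k (Ad k) (-1 * a 3))).re < 0) :
    Continuous (archWitnessR q a g g' hgg' hg'g hgΩ lam hiso w₀ eP' eM' R) :=
  (continuous_d3Gen q a g g' hgg' hg'g hgΩ lam hiso w₀ hw₀ hcm₀ ha1 ha3 _).mul
    (continuous_placeProd q a g g' hgg' hg'g hgΩ w₀ _ fun w' =>
      continuous_cutFactor q a g g' hgg' hg'g hgΩ lam hiso eP' eM' R w')

/-- continuity of the antiholomorphic branch. -/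
theorem continuous_archWitnessR' (hw₀ : w₀.IsReal) (hcm₀ : IsCMAt q w₀)
    (ha1 : 0 < (adToC w₀ (algebraMap k (Ad k) (a 1))).re) (ha3 : (adToC w₀ (algebraMap k (Ad k) (-1 * a 3))).re < 0) :
    Continuous (archWitnessR' q a g g' hgg' hg'g hgΩ lam hiso w₀ eP' eM' R) :=
  (continuous_d3Gen' q a g g' hgg' hg'g hgΩ lam hiso w₀ hw₀ hcm₀ ha1 ha3 _).mul
    (continuous_placeProd q a g g' hgg' hg'g hgΩ w₀ _ fun w' =>
      continuous_cutFactor q a g g' hgg' hg'g hgΩ lam hiso eP' eM' R w')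

/-- `infOnly`. -/
theorem archWitnessR_ofInfPart (x : GA ((PlaneData.mixedRow q (a 0) (a 2)).withTransportedTorus g g' hgg' hg'g hgΩ)) :
    archWitnessR q a g g' hgg' hg'g hgΩ lam hiso w₀ eP' eM' R x =
      archWitnessR q a g g' hgg' hg'g hgΩ lam hiso w₀ eP' eM' R (GA.ofInfPart _ x) := by
  rw [archWitnessR_apply, archWitnessR_apply, ← d3Gen_ofInfPart,
    ← placeProd_ofInfPart q a g g' hgg' hg'g hgΩ w₀ _ (cutFactor_ofInfPart q a g g' hgg' hg'g hgΩ lam hiso eP' eM' R)]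

/-- `infOnly` of the antiholomorphic branch. -/
theorem archWitnessR'_ofInfPart (x : GA ((PlaneData.mixedRow q (a 0) (a 2)).withTransportedTorus g g' hgg' hg'g hgΩ)) :
    archWitnessR' q a g g' hgg' hg'g hgΩ lam hiso w₀ eP' eM' R x =
      archWitnessR' q a g g' hgg' hg'g hgΩ lam hiso w₀ eP' eM' R (GA.ofInfPart _ x) := by
  rw [archWitnessR'_apply, archWitnessR'_apply, ← d3Gen'_ofInfPart,
    ← placeProd_ofInfPart q a g g' hgg' hg'g hgΩ w₀ _ (cutFactor_ofInfPart q a g g' hgg' hg'g hgΩ lam hiso eP' eM' R)]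

include hlam in
/-- **THE `equiv` FIELD AT EVERY PLACE for `archWitnessR`** (`he : eP′ w₀ = eM′ w₀ + 3`; every infinite place real CM). -/
theorem cj_archWitnessR_inv_mul (hall : ∀ w : InfinitePlace k, w.IsReal ∧ IsCMAt q w) (ha1 : a 1 ≠ 0) (ha3 : a 3 ≠ 0)
    (he : eP' w₀ = eM' w₀ + 3)
    (w : InfinitePlace k) (κ : GA ((PlaneData.mixedRow q (a 0) (a 2)).withTransportedTorus g g' hgg' hg'g hgΩ))
    (hκ : κ ∈ localTorusAt' ((PlaneData.mixedRow q (a 0) (a 2)).withTransportedTorus g g' hgg' hg'g hgΩ) w)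
    (y : GA ((PlaneData.mixedRow q (a 0) (a 2)).withTransportedTorus g g' hgg' hg'g hgΩ)) :
    RTF.cj (archWitnessR q a g g' hgg' hg'g hgΩ lam hiso w₀ eP' eM' R) (κ⁻¹ * y) =
      weightAt' ((PlaneData.mixedRow q (a 0) (a 2)).withTransportedTorus g g' hgg' hg'g hgΩ) q w g g' 0 κ ^ (-eP' w) *
        weightAt' ((PlaneData.mixedRow q (a 0) (a 2)).withTransportedTorus g g' hgg' hg'g hgΩ) q w g g' 1 κ ^ (-eM' w) *
        RTF.cj (archWitnessR q a g g' hgg' hg'g hgΩ lam hiso w₀ eP' eM' R) y := by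
  have hκ' : κ⁻¹ ∈ localTorusAt' ((PlaneData.mixedRow q (a 0) (a 2)).withTransportedTorus g g' hgg' hg'g hgΩ) w :=
    (localTorusAt' _ w).inv_mem hκ
  by_cases hw : w = w₀
  · subst hw
    have h1 := cj_d3Gen_inv_mul' q a g g' hgg' hg'g hgΩ lam hlam hiso w (hall w).1 (hall w).2 ha1 ha3 he hκ y
    have h2 := placeProd_mul_of_base q a g g' hgg' hg'g hgΩ w
      (cutFactor q a g g' hgg' hg'g hgΩ lam hiso eP' eM' R)
      (fun w' hw' κ hκ x => cutFactor_mul_of_mem_localTorusAt'_ne q a g g' hgg' hg'g hgΩ lam hlam hiso eP' eM' R w'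
        (hall w').1 (hall w').2 hw'.symm hκ x) hκ' y
    simp only [RTF.cj, archWitnessR, Pi.mul_apply] at h1 ⊢
    rw [h2, map_mul, map_mul, h1]
    ring
  · have h1 := d3Gen_mul_of_mem_localTorusAt'_ne q a g g' hgg' hg'g hgΩ lam hlam hiso w₀ (hall w₀).1 (hall w₀).2 hw
      (eM' w₀) hκ' y
    have h2 := cj_placeProd_inv_mul q a g g' hgg' hg'g hgΩ w₀ eP' eM'
      (cutFactor q a g g' hgg' hg'g hgΩ lam hiso eP' eM' R)
      (fun w' hw' κ hκ y => cj_cutFactor_inv_mul q a g g' hgg' hg'g hgΩ lam hlam hiso eP' eM' R w' (hall w').1 (hall w').2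
        ha1 ha3 hκ y)
      (fun w' _ w'' hne κ hκ x => cutFactor_mul_of_mem_localTorusAt'_ne q a g g' hgg' hg'g hgΩ lam hlam hiso eP' eM' R w'
        (hall w').1 (hall w').2 hne hκ x) hw hκ y
    simp only [RTF.cj, archWitnessR, Pi.mul_apply] at h2 ⊢
    rw [h1, map_mul, map_mul, h2]
    ring

include hlam in
/-- **THE `equiv` FIELD AT EVERY PLACE for `archWitnessR'`** (`he : eM′ w₀ = eP′ w₀ + 3`). -/
theorem cj_archWitnessR'_inv_mul (hall : ∀ w : InfinitePlace k, w.IsReal ∧ IsCMAt q w) (ha1 : a 1 ≠ 0) (ha3 : a 3 ≠ 0)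
    (he : eM' w₀ = eP' w₀ + 3)
    (w : InfinitePlace k) (κ : GA ((PlaneData.mixedRow q (a 0) (a 2)).withTransportedTorus g g' hgg' hg'g hgΩ))
    (hκ : κ ∈ localTorusAt' ((PlaneData.mixedRow q (a 0) (a 2)).withTransportedTorus g g' hgg' hg'g hgΩ) w)
    (y : GA ((PlaneData.mixedRow q (a 0) (a 2)).withTransportedTorus g g' hgg' hg'g hgΩ)) :
    RTF.cj (archWitnessR' q a g g' hgg' hg'g hgΩ lam hiso w₀ eP' eM' R) (κ⁻¹ * y) =
      weightAt' ((PlaneData.mixedRow q (a 0) (a 2)).withTransportedTorus g g' hgg' hg'g hgΩ) q w g g' 0 κ ^ (-eP' w) *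
        weightAt' ((PlaneData.mixedRow q (a 0) (a 2)).withTransportedTorus g g' hgg' hg'g hgΩ) q w g g' 1 κ ^ (-eM' w) *
        RTF.cj (archWitnessR' q a g g' hgg' hg'g hgΩ lam hiso w₀ eP' eM' R) y := by
  have hκ' : κ⁻¹ ∈ localTorusAt' ((PlaneData.mixedRow q (a 0) (a 2)).withTransportedTorus g g' hgg' hg'g hgΩ) w :=
    (localTorusAt' _ w).inv_mem hκ
  by_cases hw : w = w₀
  · subst hw
    have h1 := cj_d3Gen'_inv_mul' q a g g' hgg' hg'g hgΩ lam hlam hiso w (hall w).1 (hall w).2 ha1 ha3 he hκ y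
    have h2 := placeProd_mul_of_base q a g g' hgg' hg'g hgΩ w
      (cutFactor q a g g' hgg' hg'g hgΩ lam hiso eP' eM' R)
      (fun w' hw' κ hκ x => cutFactor_mul_of_mem_localTorusAt'_ne q a g g' hgg' hg'g hgΩ lam hlam hiso eP' eM' R w'
        (hall w').1 (hall w').2 hw'.symm hκ x) hκ' y
    simp only [RTF.cj, archWitnessR', Pi.mul_apply] at h1 ⊢
    rw [h2, map_mul, map_mul, h1]
    ring
  · have h1 := d3Gen'_mul_of_mem_localTorusAt'_ne q a g g' hgg' hg'g hgΩ lam hlam hiso w₀ (hall w₀).1 (hall w₀).2 hw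
      (eP' w₀) hκ' y
    have h2 := cj_placeProd_inv_mul q a g g' hgg' hg'g hgΩ w₀ eP' eM'
      (cutFactor q a g g' hgg' hg'g hgΩ lam hiso eP' eM' R)
      (fun w' hw' κ hκ y => cj_cutFactor_inv_mul q a g g' hgg' hg'g hgΩ lam hlam hiso eP' eM' R w' (hall w').1 (hall w').2
        ha1 ha3 hκ y)
      (fun w' _ w'' hne κ hκ x => cutFactor_mul_of_mem_localTorusAt'_ne q a g g' hgg' hg'g hgΩ lam hlam hiso eP' eM' R w'
        (hall w').1 (hall w').2 hne hκ x) hw hκ y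
    simp only [RTF.cj, archWitnessR', Pi.mul_apply] at h2 ⊢
    rw [h1, map_mul, map_mul, h2]
    ring

include hlam in
/-- **THE RIGHT `T′(𝔸)`-LAW of `archWitnessR`**: `archWitnessR R (x κ) = torusWeight' eP′ eM′ κ · archWitnessR R x`. -/
theorem archWitnessR_mul_torus' (hall : ∀ w : InfinitePlace k, w.IsReal ∧ IsCMAt q w) (ha1 : a 1 ≠ 0) (ha3 : a 3 ≠ 0)
    (he : eP' w₀ = eM' w₀ + 3)
    (x κ : GA ((PlaneData.mixedRow q (a 0) (a 2)).withTransportedTorus g g' hgg' hg'g hgΩ))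
    (hκ : κ ∈ torusT' ((PlaneData.mixedRow q (a 0) (a 2)).withTransportedTorus g g' hgg' hg'g hgΩ)) :
    archWitnessR q a g g' hgg' hg'g hgΩ lam hiso w₀ eP' eM' R (x * κ) =
      torusWeight' q a g g' hgg' hg'g hgΩ eP' eM' κ * archWitnessR q a g g' hgg' hg'g hgΩ lam hiso w₀ eP' eM' R x := by
  unfold torusWeight'
  rw [archWitnessR_apply, archWitnessR_apply,
    d3Gen_mul_torus' q a g g' hgg' hg'g hgΩ lam hlam hiso w₀ (hall w₀).1 (hall w₀).2 ha1 ha3 _ x κ hκ,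
    placeProd_mul_torus' q a g g' hgg' hg'g hgΩ w₀ eP' eM' _
      (fun w' _ x κ hκ => cutFactor_mul_torus' q a g g' hgg' hg'g hgΩ lam hlam hiso eP' eM' R w' (hall w').1 (hall w').2
        ha1 ha3 x κ hκ) x κ hκ,
    ← Finset.mul_prod_erase (Finset.univ : Finset (InfinitePlace k)) _ (Finset.mem_univ w₀), he]
  ring

include hlam in
/-- **THE RIGHT `T′(𝔸)`-LAW of `archWitnessR'`**. -/
theorem archWitnessR'_mul_torus' (hall : ∀ w : InfinitePlace k, w.IsReal ∧ IsCMAt q w) (ha1 : a 1 ≠ 0) (ha3 : a 3 ≠ 0)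
    (he : eM' w₀ = eP' w₀ + 3)
    (x κ : GA ((PlaneData.mixedRow q (a 0) (a 2)).withTransportedTorus g g' hgg' hg'g hgΩ))
    (hκ : κ ∈ torusT' ((PlaneData.mixedRow q (a 0) (a 2)).withTransportedTorus g g' hgg' hg'g hgΩ)) :
    archWitnessR' q a g g' hgg' hg'g hgΩ lam hiso w₀ eP' eM' R (x * κ) =
      torusWeight' q a g g' hgg' hg'g hgΩ eP' eM' κ * archWitnessR' q a g g' hgg' hg'g hgΩ lam hiso w₀ eP' eM' R x := by
  unfold torusWeight'
  rw [archWitnessR'_apply, archWitnessR'_apply,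
    d3Gen'_mul_torus' q a g g' hgg' hg'g hgΩ lam hlam hiso w₀ (hall w₀).1 (hall w₀).2 ha1 ha3 _ x κ hκ,
    placeProd_mul_torus' q a g g' hgg' hg'g hgΩ w₀ eP' eM' _
      (fun w' _ x κ hκ => cutFactor_mul_torus' q a g g' hgg' hg'g hgΩ lam hlam hiso eP' eM' R w' (hall w').1 (hall w').2
        ha1 ha3 x κ hκ) x κ hκ,
    ← Finset.mul_prod_erase (Finset.univ : Finset (InfinitePlace k)) _ (Finset.mem_univ w₀), he]
  ring

/-- the bump of the cutoff witness: `detTwist (eM′ w₀) · ∏_{w′ ≠ w₀} cutFactor R w′`. -/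
def cutBump (c : ℤ) : GA ((PlaneData.mixedRow q (a 0) (a 2)).withTransportedTorus g g' hgg' hg'g hgΩ) → ℂ :=
  detTwist q a g g' hgg' hg'g hgΩ lam hiso w₀ c *
    placeProd q a g g' hgg' hg'g hgΩ w₀ (cutFactor q a g g' hgg' hg'g hgΩ lam hiso eP' eM' R)

/-- the uniform bound of the bump: `‖cutBump c x‖ ≤ ∏_{w′ ≠ w₀} (R + 1)^{coeffDegree}` (`0 ≤ R`, `(a 1)_{w₀}, (−a 3)_{w₀} ≠ 0`). -/
theorem norm_cutBump_le (hw₀ : w₀.IsReal) (hcm₀ : IsCMAt q w₀)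
    (hA : adToC w₀ (algebraMap k (Ad k) (a 1)) ≠ 0) (hB : adToC w₀ (algebraMap k (Ad k) (-1 * a 3)) ≠ 0)
    (hR : 0 ≤ R) (c : ℤ) (x : GA ((PlaneData.mixedRow q (a 0) (a 2)).withTransportedTorus g g' hgg' hg'g hgΩ)) :
    ‖cutBump q a g g' hgg' hg'g hgΩ lam hiso w₀ eP' eM' R c x‖ ≤
      ∏ w' ∈ Finset.univ.erase w₀, (R + 1) ^ coeffDegree (eP' w') (eM' w') := by
  unfold cutBump
  rw [Pi.mul_apply, norm_mul]
  calc ‖detTwist q a g g' hgg' hg'g hgΩ lam hiso w₀ c x‖ *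
        ‖placeProd q a g g' hgg' hg'g hgΩ w₀ (cutFactor q a g g' hgg' hg'g hgΩ lam hiso eP' eM' R) x‖
      ≤ 1 * ∏ w' ∈ Finset.univ.erase w₀, (R + 1) ^ coeffDegree (eP' w') (eM' w') :=
        mul_le_mul (norm_detTwist_le_one q a g g' hgg' hg'g hgΩ lam hiso w₀ hw₀ hcm₀ hA hB c x)
          (norm_placeProd_le q a g g' hgg' hg'g hgΩ w₀ _ _
            (fun w' _ x => norm_cutFactor_le q a g g' hgg' hg'g hgΩ lam hiso eP' eM' R hR w' x) x)
          (norm_nonneg _) zero_le_one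
    _ = ∏ w' ∈ Finset.univ.erase w₀, (R + 1) ^ coeffDegree (eP' w') (eM' w') := one_mul _

include hlam in
/-- the support of the bump: every other place's size is bounded by `1 + ∑_{w′} locSizeBound w′ · (R + 1)`. -/
theorem archSizeAt_le_of_cutBump_ne_zero (hall : ∀ w : InfinitePlace k, w.IsReal ∧ IsCMAt q w) (hR : 0 ≤ R) (c : ℤ)
    (x : GA ((PlaneData.mixedRow q (a 0) (a 2)).withTransportedTorus g g' hgg' hg'g hgΩ))
    (hx : cutBump q a g g' hgg' hg'g hgΩ lam hiso w₀ eP' eM' R c x ≠ 0) (w' : InfinitePlace k) (hw' : w' ≠ w₀) :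
    ∑ i : Fin 4, ∑ j : Fin 4,
        ‖adToC w' (GA.mat ((PlaneData.mixedRow q (a 0) (a 2)).withTransportedTorus g g' hgg' hg'g hgΩ) x i j)‖ ≤
      1 + ∑ w'' : InfinitePlace k, locSizeBound q g g' w'' * (R + 1) := by
  have hprod : placeProd q a g g' hgg' hg'g hgΩ w₀ (cutFactor q a g g' hgg' hg'g hgΩ lam hiso eP' eM' R) x ≠ 0 :=
    right_ne_zero_of_mul hx
  have hfac := ne_zero_of_placeProd_ne_zero q a g g' hgg' hg'g hgΩ w₀ _ hprod hw'
  have hlt := locSize_lt_of_cutFactor_ne_zero q a g g' hgg' hg'g hgΩ lam hiso eP' eM' R w' hfac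
  have hK := locSizeBound_nonneg q g g' w'
  have hterm : locSizeBound q g g' w' * (R + 1) ≤ ∑ w'' : InfinitePlace k, locSizeBound q g g' w'' * (R + 1) :=
    Finset.single_le_sum (f := fun w'' => locSizeBound q g g' w'' * (R + 1))
      (fun w'' _ => mul_nonneg (locSizeBound_nonneg q g g' w'') (by linarith)) (Finset.mem_univ w')
  calc ∑ i : Fin 4, ∑ j : Fin 4,
        ‖adToC w' (GA.mat ((PlaneData.mixedRow q (a 0) (a 2)).withTransportedTorus g g' hgg' hg'g hgΩ) x i j)‖
      ≤ locSizeBound q g g' w' * locSize q a g g' hgg' hg'g hgΩ lam hiso w' x :=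
        archSizeAt_le_locSize q a g g' hgg' hg'g hgΩ lam hlam hiso w' (hall w').1 (hall w').2 x
    _ ≤ locSizeBound q g g' w' * (R + 1) := mul_le_mul_of_nonneg_left hlt.le hK
    _ ≤ 1 + ∑ w'' : InfinitePlace k, locSizeBound q g g' w'' * (R + 1) := by linarith

include hlam in
/-- **THE WEIGHT-3 DECAY OF `archWitnessR` WITHOUT DEFINITENESS OFF `w₀`**: every infinite place real CM, the `U(1,1)` signs
at `w₀`, `0 ≤ R` ⊢ `∃ C, ∀ x, ‖archWitnessR R x‖ ≤ C · exp (−(3 · ∑_{w′} log (max 1 (∑ᵢⱼ ‖adToC w′ (mat x i j)‖))))` —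
`hasDecay3_of_bump` (p701824) at `bump := cutBump (eM′ w₀)`. -/
theorem decay_archWitnessR (hall : ∀ w : InfinitePlace k, w.IsReal ∧ IsCMAt q w)
    (ha1 : 0 < (adToC w₀ (algebraMap k (Ad k) (a 1))).re) (ha3 : (adToC w₀ (algebraMap k (Ad k) (-1 * a 3))).re < 0)
    (hR : 0 ≤ R) :
    ∃ C : ℝ, ∀ x : GA ((PlaneData.mixedRow q (a 0) (a 2)).withTransportedTorus g g' hgg' hg'g hgΩ),
      ‖archWitnessR q a g g' hgg' hg'g hgΩ lam hiso w₀ eP' eM' R x‖ ≤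
        C * Real.exp (-(3 * ∑ w' : InfinitePlace k, Real.log (max 1 (∑ i : Fin 4, ∑ j : Fin 4,
          ‖adToC w' (GA.mat ((PlaneData.mixedRow q (a 0) (a 2)).withTransportedTorus g g' hgg' hg'g hgΩ) x i j)‖)))) := by
  have hA : adToC w₀ (algebraMap k (Ad k) (a 1)) ≠ 0 := fun h => by rw [h] at ha1; simp at ha1
  have hB : adToC w₀ (algebraMap k (Ad k) (-1 * a 3)) ≠ 0 := fun h => by rw [h] at ha3; simp at ha3
  have hM : (1 : ℝ) ≤ 1 + ∑ w'' : InfinitePlace k, locSizeBound q g g' w'' * (R + 1) := by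
    have : 0 ≤ ∑ w'' : InfinitePlace k, locSizeBound q g g' w'' * (R + 1) :=
      Finset.sum_nonneg fun w'' _ => mul_nonneg (locSizeBound_nonneg q g g' w'') (by linarith)
    linarith
  obtain ⟨C, hC⟩ := hasDecay3_of_bump q a g g' hgg' hg'g hgΩ lam hlam hiso w₀ (hall w₀).1 (hall w₀).2 ha1 ha3
    (cutBump q a g g' hgg' hg'g hgΩ lam hiso w₀ eP' eM' R (eM' w₀)) _ _ hM
    (norm_cutBump_le q a g g' hgg' hg'g hgΩ lam hiso w₀ eP' eM' R (hall w₀).1 (hall w₀).2 hA hB hR (eM' w₀))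
    (fun x hx w' hw' => archSizeAt_le_of_cutBump_ne_zero q a g g' hgg' hg'g hgΩ lam hlam hiso w₀ eP' eM' R hall hR
      (eM' w₀) x hx w' hw')
  refine ⟨C, fun x => ?_⟩
  have heq : archWitnessR q a g g' hgg' hg'g hgΩ lam hiso w₀ eP' eM' R x =
      D3coeff' q a g g' hgg' hg'g hgΩ lam hiso w₀ x * cutBump q a g g' hgg' hg'g hgΩ lam hiso w₀ eP' eM' R (eM' w₀) x := by
    rw [archWitnessR_apply, d3Gen_apply]
    unfold cutBump
    rw [Pi.mul_apply, mul_assoc]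
  rw [heq]
  exact hC x

include hlam in
/-- **THE WEIGHT-3 DECAY OF `archWitnessR'` WITHOUT DEFINITENESS OFF `w₀`** (`‖D3coeff''‖ = ‖D3coeff'‖`). -/
theorem decay_archWitnessR' (hall : ∀ w : InfinitePlace k, w.IsReal ∧ IsCMAt q w)
    (ha1 : 0 < (adToC w₀ (algebraMap k (Ad k) (a 1))).re) (ha3 : (adToC w₀ (algebraMap k (Ad k) (-1 * a 3))).re < 0)
    (hR : 0 ≤ R) :
    ∃ C : ℝ, ∀ x : GA ((PlaneData.mixedRow q (a 0) (a 2)).withTransportedTorus g g' hgg' hg'g hgΩ),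
      ‖archWitnessR' q a g g' hgg' hg'g hgΩ lam hiso w₀ eP' eM' R x‖ ≤
        C * Real.exp (-(3 * ∑ w' : InfinitePlace k, Real.log (max 1 (∑ i : Fin 4, ∑ j : Fin 4,
          ‖adToC w' (GA.mat ((PlaneData.mixedRow q (a 0) (a 2)).withTransportedTorus g g' hgg' hg'g hgΩ) x i j)‖)))) := by
  have hA : adToC w₀ (algebraMap k (Ad k) (a 1)) ≠ 0 := fun h => by rw [h] at ha1; simp at ha1
  have hB : adToC w₀ (algebraMap k (Ad k) (-1 * a 3)) ≠ 0 := fun h => by rw [h] at ha3; simp at ha3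
  have hM : (1 : ℝ) ≤ 1 + ∑ w'' : InfinitePlace k, locSizeBound q g g' w'' * (R + 1) := by
    have : 0 ≤ ∑ w'' : InfinitePlace k, locSizeBound q g g' w'' * (R + 1) :=
      Finset.sum_nonneg fun w'' _ => mul_nonneg (locSizeBound_nonneg q g g' w'') (by linarith)
    linarith
  obtain ⟨C, hC⟩ := hasDecay3_of_bump q a g g' hgg' hg'g hgΩ lam hlam hiso w₀ (hall w₀).1 (hall w₀).2 ha1 ha3
    (cutBump q a g g' hgg' hg'g hgΩ lam hiso w₀ eP' eM' R (eP' w₀)) _ _ hM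
    (norm_cutBump_le q a g g' hgg' hg'g hgΩ lam hiso w₀ eP' eM' R (hall w₀).1 (hall w₀).2 hA hB hR (eP' w₀))
    (fun x hx w' hw' => archSizeAt_le_of_cutBump_ne_zero q a g g' hgg' hg'g hgΩ lam hlam hiso w₀ eP' eM' R hall hR
      (eP' w₀) x hx w' hw')
  refine ⟨C, fun x => ?_⟩
  have heq : ‖archWitnessR' q a g g' hgg' hg'g hgΩ lam hiso w₀ eP' eM' R x‖ =
      ‖D3coeff' q a g g' hgg' hg'g hgΩ lam hiso w₀ x * cutBump q a g g' hgg' hg'g hgΩ lam hiso w₀ eP' eM' R (eP' w₀) x‖ := by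
    rw [archWitnessR'_apply, d3Gen'_apply]
    unfold cutBump
    rw [Pi.mul_apply, mul_assoc, norm_mul, norm_mul,
      norm_D3coeff''_eq_norm_D3coeff' q a g g' hgg' hg'g hgΩ lam hiso w₀ (hall w₀).1 (hall w₀).2 ha1 ha3 x, norm_mul,
      norm_mul]
  rw [heq]
  exact hC x

end Witness

end Summit.Ventures.HodgeRepro.Tier4.Line4

end
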